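import Summits.CriticalPhenomena.Ising3DConformalLimit.Theses.GaussianScaleMixture
import Literature.Probability.LatticeModels.CriticalWickDichotomy
import Literature.Probability.LatticeModels.CriticalScalingDimension
import Literature.Probability.LatticeModels.ScalingLimit3D
import Summits.CriticalPhenomena.Ising3DConformalLimit.Theorems.MoebiusLimitExists.Negative.FreeReflections
import Summits.CriticalPhenomena.Ising3DConformalLimit.Theorems.MoebiusLimitExists.Negative.ScaleRedundant
import Summits.CriticalPhenomena.Ising3DConformalLimit.Theorems.MoebiusLimitExists.Negative.RotationFromInversion
import Summits.CriticalPhenomena.Ising3DConformalLimit.Theorems.InversionUpgradeNormalised.Negative.AutomaticOrders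

/-!
# `RotationUpgradeFromTwoPoint` (item stmt-CriticalPhenomena-8367): automatic orders, free symmetries, redundant hypotheses, the Gaussian case

Structural knowledge about the crux
`Summit.CriticalPhenomena.Ising3DConformalLimit.Theses.GaussianScaleMixture.RotationUpgradeFromTwoPoint`
(standing crux disprover, D-0016, cycle 1; THEOREM-ONLY, no new definitions). Hypotheses of the crux on
`(ρ, Δ, S)`: (H1) `ρ > 0` on `(0,1]`; (H2) `HasPointwiseScalingLimit (criticalCorr 3) ρ S`;
(H3) `S = 0` off `NonCoincident`; (H4) `IsNondegenerateTwoPoint S`; (H5) `IsTranslationInvariant S`;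
(H6) `IsScaleCovariant Δ S`; (H7) `∀ R x, x ≠ 0 → S 2 ![0, R x] = S 2 ![0, x]`; conclusion
`IsRotationInvariant S`.

* AUTOMATIC ORDERS. `n = 0` (`rot_zero`), all odd `n` (`S_n ≡ 0`: `m*(β_c) = 0`, tree
  `HasPointwiseScalingLimit.eq_zero_of_odd`, + (H3)), and `n = 2` MODEL-BLIND from (H5)+(H7)
  (`two_point_rot`, coincident pairs included) ⇒ `crux_iff_evenFromFour`: the crux is the `O(3)`
  invariance of `S₄, S₆, …`; at order `4` it is exactly the `O(3)` invariance of the CONNECTED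
  function `U₄` (`rot_four_iff_connectedFour`), the Wick part being round already.
* FREE SYMMETRIES. The hyperoctahedral group `B₃` (tree `limit_coordPerm`, `limit_signFlip`) and
  `-1` (`limit_neg`) act trivially on every instance (`coordPerm_free`, `signFlip_free`, `neg_free`,
  `rot_iff_negRot`): only `SO(3)` modulo `B₃` is asked.
* REDUNDANT HYPOTHESES. (H5) follows from (H2)+(H3) (`translation_redundant`), (H6) with SOME
  `Δ' ∈ [1/2,1]` from (H1)–(H4) (`scale_redundant`) ⇒ `crux_iff_core`: the crux is equivalent to
  "(H1)+(H2)+(H3)+(H4)+(H7) ⇒ rotation invariance", with no `Δ`; and `Δ ∈ [1/2,1]` for every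
  instance (`delta_mem_Icc_of_hyp`). `two_point_law`: `S₂(a,b) = ‖a-b‖^{-2Δ} S₂(0,e₀)`.
* INVERSION FIRST. If every instance is inversion covariant (an inversion upgrade that does NOT
  presuppose rotations), the crux follows (`crux_of_inversionUpgrade`, tree
  `isRotationInvariant_of_inversion`).
* THE GAUSSIAN ALTERNATIVE IS TRUE. If `U₄ ≡ 0` on non-coincident quadruples, every `S_{2m}` is the
  Wick sum of the round `S₂` (tree Aizenman–Newman dichotomy
  `HasPointwiseScalingLimit.eq_pairingSum_of_limitConnectedFour_eq_zero`) hence `O(3)` invariant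
  (`isRotationInvariant_of_gaussian`, `rotationInvariant_or_nontrivialU4`): the open content of the
  crux lives in the non-Gaussian alternative, which the route needs anyway (crux (E)).
-/

noncomputable section

namespace Summit.CriticalPhenomena.Ising3DConformalLimit.RotationUpgradeFromTwoPointNegative

open Literature.Probability.LatticeModels Literature.Barriers.CriticalPhenomena
open Filter Set Function ScaleNotMoebius
open Summit.CriticalPhenomena.Ising3DConformalLimit.MoebiusLimitExistsNegative
open Summit.CriticalPhenomena.Ising3DConformalLimit.Theses.GaussianScaleMixture (RotationUpgradeFromTwoPoint)
open scoped Topology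

variable {ρ : ℝ → ℝ} {Δ : ℝ} {S : CorrFamily 3}

/-! ## Orders `0`, odd, `2` -/

/-- `n = 0`: automatic for every family. [folklore] -/
theorem rot_zero (S : CorrFamily 3) (R : (EuclideanSpace ℝ (Fin 3)) ≃ₗᵢ[ℝ] (EuclideanSpace ℝ (Fin 3))) (x : Fin 0 → (EuclideanSpace ℝ (Fin 3))) :
    S 0 (fun i => R (x i)) = S 0 x := by
  have hx : (fun i => R (x i)) = x := funext fun i => i.elim0
  rw [hx]

/-- ODD ORDERS of the conclusion are automatic under (H2)+(H3) (`S n ≡ 0`, tree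
`InversionUpgradeNormalisedNegative.limit_odd_eq_zero`). [cite: AizenmanDuminilCopinSidoraviciusCMP2015, Thm. 1.2] -/
theorem rot_odd (hlim : HasPointwiseScalingLimit (criticalCorr 3) ρ S)
    (hnorm : ∀ n z, z ∉ NonCoincident 3 n → S n z = 0) {n : ℕ} (hn : Odd n)
    (R : (EuclideanSpace ℝ (Fin 3)) ≃ₗᵢ[ℝ] (EuclideanSpace ℝ (Fin 3))) (x : Fin n → (EuclideanSpace ℝ (Fin 3))) : S n (fun i => R (x i)) = S n x := by
  rw [InversionUpgradeNormalisedNegative.limit_odd_eq_zero hlim hnorm hn,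
    InversionUpgradeNormalisedNegative.limit_odd_eq_zero hlim hnorm hn]

/-- Translation invariance at order two: `S₂(a,b) = S₂(0, b - a)` (all `a, b`). [folklore] -/
theorem two_point_transl (htr : IsTranslationInvariant S) (a b : (EuclideanSpace ℝ (Fin 3))) :
    S 2 ![a, b] = S 2 ![0, b - a] := by
  have h := htr 2 (-a) ![a, b]
  rw [← h]
  congr 1
  funext i
  fin_cases i <;> simp [sub_eq_add_neg]

/-- (H5) + (H7) give FULL `O(3)` invariance of `S₂`, at every pair of points (coincident pairs
included: both sides are `S₂(0,0)`). MODEL-BLIND. [folklore] -/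
theorem two_point_rot (htr : IsTranslationInvariant S)
    (hiso : ∀ (R : (EuclideanSpace ℝ (Fin 3)) ≃ₗᵢ[ℝ] (EuclideanSpace ℝ (Fin 3))) (x : (EuclideanSpace ℝ (Fin 3))), x ≠ 0 → S 2 ![0, R x] = S 2 ![0, x])
    (R : (EuclideanSpace ℝ (Fin 3)) ≃ₗᵢ[ℝ] (EuclideanSpace ℝ (Fin 3))) (a b : (EuclideanSpace ℝ (Fin 3))) : S 2 ![R a, R b] = S 2 ![a, b] := by
  rw [two_point_transl htr (R a) (R b), two_point_transl htr a b, ← map_sub]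
  by_cases hab : b - a = 0
  · rw [hab, map_zero]
  · exact hiso R (b - a) hab

/-- The two-point function is symmetric under (H5) + (H7) (use `R = -1`). [folklore] -/
theorem two_point_symm (htr : IsTranslationInvariant S)
    (hiso : ∀ (R : (EuclideanSpace ℝ (Fin 3)) ≃ₗᵢ[ℝ] (EuclideanSpace ℝ (Fin 3))) (x : (EuclideanSpace ℝ (Fin 3))), x ≠ 0 → S 2 ![0, R x] = S 2 ![0, x])
    (p q : (EuclideanSpace ℝ (Fin 3))) : S 2 ![p, q] = S 2 ![q, p] := by
  rw [two_point_transl htr p q, two_point_transl htr q p]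
  by_cases h : q - p = 0
  · have h' : p - q = 0 := by rw [← neg_sub, h, neg_zero]
    rw [h, h']
  · have := hiso (LinearIsometryEquiv.neg ℝ) (q - p) h
    simp only [LinearIsometryEquiv.coe_neg] at this
    rw [← this]
    congr 2
    abel

/-- `n = 2` of the conclusion is automatic and MODEL-BLIND from (H5)+(H7). [folklore] -/
theorem rot_two (htr : IsTranslationInvariant S)
    (hiso : ∀ (R : (EuclideanSpace ℝ (Fin 3)) ≃ₗᵢ[ℝ] (EuclideanSpace ℝ (Fin 3))) (x : (EuclideanSpace ℝ (Fin 3))), x ≠ 0 → S 2 ![0, R x] = S 2 ![0, x])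
    (R : (EuclideanSpace ℝ (Fin 3)) ≃ₗᵢ[ℝ] (EuclideanSpace ℝ (Fin 3))) (x : Fin 2 → (EuclideanSpace ℝ (Fin 3))) : S 2 (fun i => R (x i)) = S 2 x := by
  have hx : x = ![x 0, x 1] := by funext i; fin_cases i <;> rfl
  have hRx : (fun i => R (x i)) = ![R (x 0), R (x 1)] := by funext i; fin_cases i <;> rfl
  rw [hRx]
  conv_rhs => rw [hx]
  exact two_point_rot htr hiso R (x 0) (x 1)

/-- **REDUCTION 1.** The crux is equivalent to its EVEN orders `n ≥ 4`. [folklore] -/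
theorem crux_iff_evenFromFour :
    RotationUpgradeFromTwoPoint ↔
      ∀ (ρ : ℝ → ℝ) (Δ : ℝ) (S : CorrFamily 3), (∀ δ ∈ Set.Ioc (0:ℝ) 1, 0 < ρ δ) →
        HasPointwiseScalingLimit (criticalCorr 3) ρ S → (∀ n z, z ∉ NonCoincident 3 n → S n z = 0) →
        IsNondegenerateTwoPoint S → IsTranslationInvariant S → IsScaleCovariant Δ S →
        (∀ (R : (EuclideanSpace ℝ (Fin 3)) ≃ₗᵢ[ℝ] (EuclideanSpace ℝ (Fin 3))) (x : (EuclideanSpace ℝ (Fin 3))), x ≠ 0 → S 2 ![0, R x] = S 2 ![0, x]) →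
        ∀ n, 4 ≤ n → Even n → ∀ (R : (EuclideanSpace ℝ (Fin 3)) ≃ₗᵢ[ℝ] (EuclideanSpace ℝ (Fin 3))) (x : Fin n → (EuclideanSpace ℝ (Fin 3))), S n (fun i => R (x i)) = S n x := by
  constructor
  · intro h ρ Δ S h1 h2 h3 h4 h5 h6 h7 n _ _ R x
    exact h ρ Δ S h1 h2 h3 h4 h5 h6 h7 n R x
  · intro h ρ Δ S h1 h2 h3 h4 h5 h6 h7 n R x
    rcases Nat.even_or_odd n with hev | hodd
    · by_cases h4' : 4 ≤ n
      · exact h ρ Δ S h1 h2 h3 h4 h5 h6 h7 n h4' hev R x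
      · interval_cases n
        · exact rot_zero S R x
        · exact absurd hev (by decide)
        · exact rot_two h5 h7 R x
        · exact absurd hev (by decide)
    · exact rot_odd h2 h3 hodd R x

/-- **Four-point split.** Under (H5)+(H7) rotating a quadruple changes `S₄` exactly as it changes
the connected function `U₄` (the Wick part is already round). [folklore] -/
theorem limitConnectedFour_rot_sub (htr : IsTranslationInvariant S)
    (hiso : ∀ (R : (EuclideanSpace ℝ (Fin 3)) ≃ₗᵢ[ℝ] (EuclideanSpace ℝ (Fin 3))) (x : (EuclideanSpace ℝ (Fin 3))), x ≠ 0 → S 2 ![0, R x] = S 2 ![0, x])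
    (R : (EuclideanSpace ℝ (Fin 3)) ≃ₗᵢ[ℝ] (EuclideanSpace ℝ (Fin 3))) (x : Fin 4 → (EuclideanSpace ℝ (Fin 3))) :
    limitConnectedFour S (fun i => R (x i)) - limitConnectedFour S x =
      S 4 (fun i => R (x i)) - S 4 x := by
  simp only [limitConnectedFour, two_point_rot htr hiso]
  ring

/-- Hence the order-4 clause of the crux IS the `O(3)` invariance of `U₄`. [folklore] -/
theorem rot_four_iff_connectedFour (htr : IsTranslationInvariant S)
    (hiso : ∀ (R : (EuclideanSpace ℝ (Fin 3)) ≃ₗᵢ[ℝ] (EuclideanSpace ℝ (Fin 3))) (x : (EuclideanSpace ℝ (Fin 3))), x ≠ 0 → S 2 ![0, R x] = S 2 ![0, x]) :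
    (∀ (R : (EuclideanSpace ℝ (Fin 3)) ≃ₗᵢ[ℝ] (EuclideanSpace ℝ (Fin 3))) (x : Fin 4 → (EuclideanSpace ℝ (Fin 3))), S 4 (fun i => R (x i)) = S 4 x) ↔
      ∀ (R : (EuclideanSpace ℝ (Fin 3)) ≃ₗᵢ[ℝ] (EuclideanSpace ℝ (Fin 3))) (x : Fin 4 → (EuclideanSpace ℝ (Fin 3))),
        limitConnectedFour S (fun i => R (x i)) = limitConnectedFour S x := by
  constructor
  · intro h R x
    have := limitConnectedFour_rot_sub htr hiso R x
    rw [h R x, sub_self] at this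
    linarith
  · intro h R x
    have := limitConnectedFour_rot_sub htr hiso R x
    rw [h R x, sub_self] at this
    linarith

/-! ## Free symmetries: `B₃` and `-1` -/

/-- **Coordinate permutations are FREE** under (H2)+(H3) (tree `limit_coordPerm`).
[cite: FriedliVelenik2017, Exercise 3.14, p. 115] -/
theorem coordPerm_free (hlim : HasPointwiseScalingLimit (criticalCorr 3) ρ S)
    (hnorm : ∀ n z, z ∉ NonCoincident 3 n → S n z = 0) (π : Equiv.Perm (Fin 3)) (n : ℕ)
    (x : Fin n → (EuclideanSpace ℝ (Fin 3))) :
    S n (fun i => LinearIsometryEquiv.piLpCongrLeft 2 ℝ ℝ π (x i)) = S n x := by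
  by_cases hx : x ∈ NonCoincident 3 n
  · exact limit_coordPerm hlim π hx
  · rw [hnorm n x hx, hnorm n _ (mt (map_mem_nonCoincident_iff _ x).1 hx)]

/-- **Coordinate sign flips are FREE** under (H2)+(H3) (tree `limit_signFlip`).
[cite: FriedliVelenik2017, Exercise 3.14, p. 115] -/
theorem signFlip_free (hlim : HasPointwiseScalingLimit (criticalCorr 3) ρ S)
    (hnorm : ∀ n z, z ∉ NonCoincident 3 n → S n z = 0) (ε : Fin 3 → ℤˣ) (R : (EuclideanSpace ℝ (Fin 3)) ≃ₗᵢ[ℝ] (EuclideanSpace ℝ (Fin 3)))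
    (hR : ∀ (p : (EuclideanSpace ℝ (Fin 3))) (j : Fin 3), R p j = ((ε j : ℤ) : ℝ) * p j) (n : ℕ) (x : Fin n → (EuclideanSpace ℝ (Fin 3))) :
    S n (fun i => R (x i)) = S n x := by
  by_cases hx : x ∈ NonCoincident 3 n
  · exact limit_signFlip hlim ε R hR hx
  · rw [hnorm n x hx, hnorm n _ (mt (map_mem_nonCoincident_iff R x).1 hx)]

/-- **The point reflection `-1` is FREE** under (H2)+(H3) (tree `limit_neg`): the crux is about
proper rotations only. [cite: FriedliVelenik2017, Exercise 3.14, p. 115] -/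
theorem neg_free (hlim : HasPointwiseScalingLimit (criticalCorr 3) ρ S)
    (hnorm : ∀ n z, z ∉ NonCoincident 3 n → S n z = 0) (n : ℕ) (x : Fin n → (EuclideanSpace ℝ (Fin 3))) :
    S n (fun i => -x i) = S n x := by
  by_cases hx : x ∈ NonCoincident 3 n
  · exact limit_neg hlim hx
  · rw [hnorm n x hx, hnorm n _ ?_]
    have := mt (map_mem_nonCoincident_iff (LinearIsometryEquiv.neg ℝ) x).1 hx
    simpa using this

/-- Invariance under `R` and under `-R` are equivalent for a limit. [folklore] -/
theorem rot_iff_negRot (hlim : HasPointwiseScalingLimit (criticalCorr 3) ρ S)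
    (hnorm : ∀ n z, z ∉ NonCoincident 3 n → S n z = 0) (R : (EuclideanSpace ℝ (Fin 3)) ≃ₗᵢ[ℝ] (EuclideanSpace ℝ (Fin 3))) (n : ℕ)
    (x : Fin n → (EuclideanSpace ℝ (Fin 3))) :
    S n (fun i => R (x i)) = S n x ↔ S n (fun i => -R (x i)) = S n x := by
  rw [neg_free hlim hnorm n (fun i => R (x i))]

/-! ## Redundant hypotheses and the `Δ`-free core -/

open Classical in
/-- Under (H3), `S` coincides with its own normalisation. [folklore] -/
theorem normalised_eq (hnorm : ∀ n z, z ∉ NonCoincident 3 n → S n z = 0) :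
    (fun n x => if x ∈ NonCoincident 3 n then S n x else 0) = S := by
  funext n x
  split_ifs with hx
  · rfl
  · exact (hnorm n x hx).symm

open Classical in
/-- **(H5) is REDUNDANT**: translation invariance follows from (H2)+(H3). [cite: FriedliVelenik2017, Thm. 3.17] -/
theorem translation_redundant (hlim : HasPointwiseScalingLimit (criticalCorr 3) ρ S)
    (hnorm : ∀ n z, z ∉ NonCoincident 3 n → S n z = 0) : IsTranslationInvariant S := by
  have h := isTranslationInvariant_normalised_of_limit hlim
  rwa [normalised_eq hnorm] at h

open Classical in
/-- **(H6) is REDUNDANT**: scale covariance with SOME `Δ' ∈ [1/2, 1]` follows from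
(H1)+(H2)+(H3)+(H4) (tree `exists_scaleCovariant_normalised`). [cite: Simon1980, Thm. 1] -/
theorem scale_redundant (hρ : ∀ δ ∈ Set.Ioc (0:ℝ) 1, 0 < ρ δ)
    (hlim : HasPointwiseScalingLimit (criticalCorr 3) ρ S)
    (hnorm : ∀ n z, z ∉ NonCoincident 3 n → S n z = 0) (hnd : IsNondegenerateTwoPoint S) :
    ∃ Δ' ∈ Set.Icc (1 / 2 : ℝ) 1, IsScaleCovariant Δ' S := by
  obtain ⟨Δ', hΔ', hsc⟩ := exists_scaleCovariant_normalised hρ hlim hnd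
  refine ⟨Δ', hΔ', ?_⟩
  rwa [normalised_eq hnorm] at hsc

/-- **REDUCTION 2.** The crux is equivalent to its `Δ`-free CORE "(H1)+(H2)+(H3)+(H4)+(H7) ⇒
rotation invariance": the binders `Δ`, (H5), (H6) carry no information. [folklore] -/
theorem crux_iff_core :
    RotationUpgradeFromTwoPoint ↔
      ∀ (ρ : ℝ → ℝ) (S : CorrFamily 3), (∀ δ ∈ Set.Ioc (0:ℝ) 1, 0 < ρ δ) →
        HasPointwiseScalingLimit (criticalCorr 3) ρ S → (∀ n z, z ∉ NonCoincident 3 n → S n z = 0) →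
        IsNondegenerateTwoPoint S →
        (∀ (R : (EuclideanSpace ℝ (Fin 3)) ≃ₗᵢ[ℝ] (EuclideanSpace ℝ (Fin 3))) (x : (EuclideanSpace ℝ (Fin 3))), x ≠ 0 → S 2 ![0, R x] = S 2 ![0, x]) →
        IsRotationInvariant S := by
  constructor
  · intro h ρ S h1 h2 h3 h4 h7
    obtain ⟨Δ', -, h6⟩ := scale_redundant h1 h2 h3 h4
    exact h ρ Δ' S h1 h2 h3 h4 (translation_redundant h2 h3) h6 h7
  · intro h ρ Δ S h1 h2 h3 h4 _ _ h7
    exact h ρ S h1 h2 h3 h4 h7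

/-- **Δ is pinned to the Ising window** `[1/2, 1]` for every instance (tree
`scalingDimension_mem_Icc_holds`). [cite: Simon1980, Thm. 1] -/
theorem delta_mem_Icc_of_hyp (hρ : ∀ δ ∈ Set.Ioc (0:ℝ) 1, 0 < ρ δ)
    (hlim : HasPointwiseScalingLimit (criticalCorr 3) ρ S) (hnd : IsNondegenerateTwoPoint S)
    (hsc : IsScaleCovariant Δ S) : Δ ∈ Set.Icc (1 / 2 : ℝ) 1 :=
  scalingDimension_mem_Icc_holds ρ Δ S hlim hsc hnd hρ

/-- **Two-point law.** (H5)+(H6)+(H7) pin `S₂(a,b) = ‖a - b‖^{-2Δ} · S₂(0,e₀)` for `a ≠ b`.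
MODEL-BLIND. [folklore] -/
theorem two_point_law (htr : IsTranslationInvariant S) (hsc : IsScaleCovariant Δ S)
    (hiso : ∀ (R : (EuclideanSpace ℝ (Fin 3)) ≃ₗᵢ[ℝ] (EuclideanSpace ℝ (Fin 3))) (x : (EuclideanSpace ℝ (Fin 3))), x ≠ 0 → S 2 ![0, R x] = S 2 ![0, x])
    {a b : (EuclideanSpace ℝ (Fin 3))} (hab : a ≠ b) :
    S 2 ![a, b] = ‖a - b‖ ^ (-(2 * Δ)) * S 2 ![0, axisUnit] := by
  set r : ℝ := ‖b - a‖ with hr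
  have hr0 : 0 < r := norm_pos_iff.mpr (sub_ne_zero.mpr (Ne.symm hab))
  have hba : b - a ≠ 0 := sub_ne_zero.mpr (Ne.symm hab)
  have h1 : S 2 ![a, b] = S 2 ![0, b - a] := two_point_transl htr a b
  have hnorm_eq : ‖b - a‖ = ‖r • axisUnit‖ := by
    rw [norm_smul, norm_axisUnit, mul_one, Real.norm_eq_abs, abs_of_pos hr0]
  have hRv : Submodule.reflection (ℝ ∙ ((b - a) - r • axisUnit))ᗮ (b - a) = r • axisUnit :=
    Submodule.reflection_sub hnorm_eq
  have h2 : S 2 ![0, b - a] = S 2 ![0, r • axisUnit] := by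
    rw [← hRv]
    exact (hiso _ (b - a) hba).symm
  have h3 : S 2 ![0, r • axisUnit] = r ^ (-(2 * Δ)) * S 2 ![0, axisUnit] := by
    have h := hsc 2 r hr0 ![0, axisUnit]
    have hfun : (fun i => r • (![0, axisUnit] : Fin 2 → (EuclideanSpace ℝ (Fin 3))) i) = ![0, r • axisUnit] := by
      funext i
      fin_cases i <;> simp
    have hexp : (-((2 : ℕ) : ℝ) * Δ) = -(2 * Δ) := by push_cast; ring
    rw [hfun, hexp] at h
    exact h
  rw [h1, h2, h3, hr, norm_sub_rev]

/-! ## The crux follows from an inversion-first upgrade -/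

/-- If every instance of the hypotheses is INVERSION covariant (an inversion upgrade that does
not presuppose rotations), the crux follows (tree `isRotationInvariant_of_inversion`: reflections
are words in inversions, translations and dilations). [folklore] -/
theorem crux_of_inversionUpgrade
    (hinv : ∀ (ρ : ℝ → ℝ) (Δ : ℝ) (S : CorrFamily 3), (∀ δ ∈ Set.Ioc (0:ℝ) 1, 0 < ρ δ) →
      HasPointwiseScalingLimit (criticalCorr 3) ρ S → (∀ n z, z ∉ NonCoincident 3 n → S n z = 0) →
      IsNondegenerateTwoPoint S → IsTranslationInvariant S → IsScaleCovariant Δ S →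
      (∀ (R : (EuclideanSpace ℝ (Fin 3)) ≃ₗᵢ[ℝ] (EuclideanSpace ℝ (Fin 3))) (x : (EuclideanSpace ℝ (Fin 3))), x ≠ 0 → S 2 ![0, R x] = S 2 ![0, x]) →
      IsInversionCovariant Δ S) :
    RotationUpgradeFromTwoPoint := by
  intro ρ Δ S h1 h2 h3 h4 h5 h6 h7
  exact isRotationInvariant_of_inversion h5 h6 (hinv ρ Δ S h1 h2 h3 h4 h5 h6 h7)
    (fun p q _ => two_point_symm h5 h7 p q) h4

/-! ## The Gaussian alternative of the crux is TRUE -/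

/-- Wick pairing sums of an `O(3)`-invariant two-point function are `O(3)` invariant. [folklore] -/
theorem pairingSum_rot (htr : IsTranslationInvariant S)
    (hiso : ∀ (R : (EuclideanSpace ℝ (Fin 3)) ≃ₗᵢ[ℝ] (EuclideanSpace ℝ (Fin 3))) (x : (EuclideanSpace ℝ (Fin 3))), x ≠ 0 → S 2 ![0, R x] = S 2 ![0, x]) (m : ℕ)
    (R : (EuclideanSpace ℝ (Fin 3)) ≃ₗᵢ[ℝ] (EuclideanSpace ℝ (Fin 3))) (x : Fin (2 * m) → (EuclideanSpace ℝ (Fin 3))) :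
    pairingSum (fun p q => S 2 ![p, q]) m (fun i => R (x i)) =
      pairingSum (fun p q => S 2 ![p, q]) m x := by
  have hfun : (fun p q => S 2 ![R p, R q]) = fun p q => S 2 ![p, q] := by
    funext p q
    exact two_point_rot htr hiso R p q
  have : pairingSum (fun p q => S 2 ![p, q]) m (fun i => R (x i)) =
      pairingSum (fun p q => S 2 ![R p, R q]) m x := rfl
  rw [this, hfun]

/-- **The crux holds for every GAUSSIAN instance**: (H2)+(H3)+(H5)+(H7) and `U₄ ≡ 0` on
non-coincident quadruples force `O(3)` invariance of every `Sₙ` (Aizenman–Newman dichotomy, tree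
`HasPointwiseScalingLimit.eq_pairingSum_of_limitConnectedFour_eq_zero`). [cite: AizenmanCDM2020, §7, Prop. 7.2] -/
theorem isRotationInvariant_of_gaussian (hlim : HasPointwiseScalingLimit (criticalCorr 3) ρ S)
    (hnorm : ∀ n z, z ∉ NonCoincident 3 n → S n z = 0) (htr : IsTranslationInvariant S)
    (hiso : ∀ (R : (EuclideanSpace ℝ (Fin 3)) ≃ₗᵢ[ℝ] (EuclideanSpace ℝ (Fin 3))) (x : (EuclideanSpace ℝ (Fin 3))), x ≠ 0 → S 2 ![0, R x] = S 2 ![0, x])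
    (hU : ∀ z ∈ NonCoincident 3 4, limitConnectedFour S z = 0) : IsRotationInvariant S := by
  intro n R x
  rcases Nat.even_or_odd n with hev | hodd
  · by_cases h4 : 4 ≤ n
    · obtain ⟨m, rfl⟩ : ∃ m, n = 2 * m := by
        obtain ⟨r, hr⟩ := hev
        exact ⟨r, by omega⟩
      have hm2 : 2 ≤ m := by omega
      by_cases hx : x ∈ NonCoincident 3 (2 * m)
      · have hRx := (map_mem_nonCoincident_iff R x).2 hx
        rw [hlim.eq_pairingSum_of_limitConnectedFour_eq_zero (by norm_num) hU hm2 hRx,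
          hlim.eq_pairingSum_of_limitConnectedFour_eq_zero (by norm_num) hU hm2 hx]
        exact pairingSum_rot htr hiso m R x
      · rw [hnorm _ x hx, hnorm _ _ (mt (map_mem_nonCoincident_iff R x).1 hx)]
    · interval_cases n
      · exact rot_zero S R x
      · exact absurd hev (by decide)
      · exact rot_two htr hiso R x
      · exact absurd hev (by decide)
  · exact rot_odd hlim hnorm hodd R x

/-- Equivalently: every instance of the hypotheses is EITHER rotation invariant OR has a
non-trivial `U₄`. [folklore] -/
theorem rotationInvariant_or_nontrivialU4 (hlim : HasPointwiseScalingLimit (criticalCorr 3) ρ S)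
    (hnorm : ∀ n z, z ∉ NonCoincident 3 n → S n z = 0) (htr : IsTranslationInvariant S)
    (hiso : ∀ (R : (EuclideanSpace ℝ (Fin 3)) ≃ₗᵢ[ℝ] (EuclideanSpace ℝ (Fin 3))) (x : (EuclideanSpace ℝ (Fin 3))), x ≠ 0 → S 2 ![0, R x] = S 2 ![0, x]) :
    IsRotationInvariant S ∨ HasNontrivialU4 S := by
  by_cases hU : ∀ z ∈ NonCoincident 3 4, limitConnectedFour S z = 0
  · exact Or.inl (isRotationInvariant_of_gaussian hlim hnorm htr hiso hU)
  · refine Or.inr ?_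
    by_contra hnt
    exact hU fun z hz => by_contra fun hne => hnt ⟨z, hz, hne⟩

/-- The crux restricted to Gaussian instances, in the crux's own binder shape. [folklore] -/
theorem crux_of_gaussian :
    ∀ (ρ : ℝ → ℝ) (Δ : ℝ) (S : CorrFamily 3), (∀ δ ∈ Set.Ioc (0:ℝ) 1, 0 < ρ δ) →
      HasPointwiseScalingLimit (criticalCorr 3) ρ S → (∀ n z, z ∉ NonCoincident 3 n → S n z = 0) →
      IsNondegenerateTwoPoint S → IsTranslationInvariant S → IsScaleCovariant Δ S →
      (∀ (R : (EuclideanSpace ℝ (Fin 3)) ≃ₗᵢ[ℝ] (EuclideanSpace ℝ (Fin 3))) (x : (EuclideanSpace ℝ (Fin 3))), x ≠ 0 → S 2 ![0, R x] = S 2 ![0, x]) →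
      (∀ z ∈ NonCoincident 3 4, limitConnectedFour S z = 0) → IsRotationInvariant S :=
  fun _ _ _ _ h2 h3 _ h5 _ h7 hU => isRotationInvariant_of_gaussian h2 h3 h5 h7 hU

end Summit.CriticalPhenomena.Ising3DConformalLimit.RotationUpgradeFromTwoPointNegative

end
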